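import Mathlib.Analysis.SpecialFunctions.Pow.Real
import Mathlib.Analysis.SpecialFunctions.Pow.Asymptotics
import Summits.MatrixMultiplication.MatrixMultiplication.Theses.AssociativePencil
import Literature.Computability.AlgebraicComplexity.TensorRestrictionRank

/-!
# `AssociativePencil.RankBoundToOmega` (stmt-MatrixMultiplication-7195) — proved

Route `MatrixMultiplication/AssociativePencil`, support item `RankBoundToOmega` (bookkeeping, "one
format at a time suffices"): if for some `C > 0` and infinitely many `n ≥ 2` one has
`R(⟨n,n,n⟩) ≤ C·n^{2+ε}`, then `ω(ℂ) ≤ 2 + ε`.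

Proof (Bläser 2013, Thm. 5.9 / BCS Prop. 15.5, in tree as the PROVED
`rpow_omega_le_tensorRank_matMulTensor : n^ω ≤ R(⟨n,n,n⟩)` for `n ≥ 2`): for every `η > 0` choose
`n₀` with `C ≤ n₀^η` (`x ↦ x^η → ∞`), take `n ≥ n₀`, `n ≥ 2` from the hypothesis, and chain
`n^ω ≤ R(⟨n,n,n⟩) ≤ C·n^{2+ε} ≤ n^η·n^{2+ε} = n^{2+ε+η}`; comparing exponents at base `n > 1` gives
`ω ≤ 2 + ε + η`, and `η → 0`.

Imports only `TensorRestrictionRank` on the Literature side (all PROVED; the named fact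
`Blaser2013Thm59` is discharged there by `Blaser2013Thm59_holds`), so no undischarged named fact
enters the cone of the route's deciding theorem.
-/

namespace Summit.MatrixMultiplication.MatrixMultiplication.Theorems

open Filter
open Literature.Computability.AlgebraicComplexity

/-- **`RankBoundToOmega` holds** (route AssociativePencil, stmt-MatrixMultiplication-7195): for
`ε > 0` and `C > 0`, if for every `n₀` there is `n ≥ n₀`, `n ≥ 2` with `R(⟨n,n,n⟩) ≤ C·n^{2+ε}`,
then `ω(ℂ) ≤ 2 + ε`. From `n^ω ≤ R(⟨n,n,n⟩)` (Bläser 2013, Thm. 5.9; tree theorem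
`rpow_omega_le_tensorRank_matMulTensor`), absorbing the constant `C ≤ n^η` for `n` large and
comparing exponents at base `n > 1`. [folklore] -/
theorem rankBoundToOmega_proof :
    Summit.MatrixMultiplication.MatrixMultiplication.Theses.AssociativePencil.RankBoundToOmega := by
  unfold Summit.MatrixMultiplication.MatrixMultiplication.Theses.AssociativePencil.RankBoundToOmega
  intro ε _hε C _hC h
  refine le_of_forall_pos_le_add fun η hη => ?_
  -- choose `n₀` with `C ≤ n₀ ^ η`
  obtain ⟨n₀, hn₀⟩ : ∃ n₀ : ℕ, C ≤ (n₀ : ℝ) ^ η := by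
    have ht := ((tendsto_rpow_atTop hη).comp tendsto_natCast_atTop_atTop).eventually
      (eventually_ge_atTop C)
    obtain ⟨n₀, hn₀⟩ := ht.exists
    exact ⟨n₀, hn₀⟩
  obtain ⟨n, hn₀n, hn2, hR⟩ := h n₀
  have hn1 : (1 : ℝ) < n := by exact_mod_cast hn2
  have hn0 : (0 : ℝ) < n := lt_trans zero_lt_one hn1
  -- `C ≤ n₀^η ≤ n^η`
  have hCn : C ≤ (n : ℝ) ^ η :=
    hn₀.trans (Real.rpow_le_rpow (Nat.cast_nonneg _) (by exact_mod_cast hn₀n) hη.le)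
  -- `n^ω ≤ R(⟨n,n,n⟩) ≤ C n^{2+ε} ≤ n^{2+ε+η}`
  have hmain : (n : ℝ) ^ omega ℂ ≤ (n : ℝ) ^ (2 + ε + η) :=
    calc (n : ℝ) ^ omega ℂ ≤ tensorRank (matMulTensor ℂ n n n) :=
          rpow_omega_le_tensorRank_matMulTensor ℂ hn2
      _ ≤ C * (n : ℝ) ^ (2 + ε) := hR
      _ ≤ (n : ℝ) ^ η * (n : ℝ) ^ (2 + ε) :=
          mul_le_mul_of_nonneg_right hCn (Real.rpow_nonneg hn0.le _)
      _ = (n : ℝ) ^ (2 + ε + η) := by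
          rw [← Real.rpow_add hn0]
          ring_nf
  exact (Real.rpow_le_rpow_left_iff hn1).1 hmain

end Summit.MatrixMultiplication.MatrixMultiplication.Theorems
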